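import Summits.ResolutionOfSingularities.ResolutionOfSingularities.Theorems.ValuativeLuAlphaPTorsorPthPowerModMonomial

/-!
# Derivation infrastructure on the local ring of a finitely generated model at the centre

Helper file for the line `pfaff-line-log-final-forms` of the crux `Valuative.LuAlphaPTorsor`
(item `stmt-ResolutionOfSingularities-0641`), sub-goals H7a/H7b of the lead's skeleton.

Setting: `k ⊆ K` fields, `char k = p`, `O` a valuation ring of `K`, `A ⊆ O` a finitely generated
`k`-subalgebra of `K`, and `R = A_𝔭` the local ring of the model `A` at the centre
`𝔭 = 𝔪_O ∩ A` of the valuation, ASSUMED regular. Two facts about `Der_ℤ(R)`: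

* `rich_localization_centre` (H7a) — **richness**: for a ring homomorphism `ψ : R → N`, a
  `ψ`-derivation `δ₀ : R → N` and a finite `Y ⊆ R` there are finitely many `Δ_j ∈ Der_ℤ(R)` and
  `n_j ∈ N` with `δ₀ y = ∑_j ψ(Δ_j y) n_j` on `Y`. This is `exists_derivations_sum_eq`
  (`…PthPowerModMonomialRichness.lean`) through a presentation `k[X]_𝔮 ↠ R`
  (`exists_presentation`, `exists_surjective_lift`).
* `exists_dual_derivations_centre` (H7b) — **dual derivations** for an ARBITRARY regular system
  of parameters `u_1, …, u_d` of `R` (`(u) = 𝔪`, `d = dim R`): `D_1, …, D_d ∈ Der_ℤ(R)` with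
  `D_i u_j = δ_ij`. Proof (`exists_dual_derivations_of_presentation`): enlarge a presentation
  `Φ : k[X_1, …, X_n] → R` by new variables `Y_j ↦ u_j`; the enlarged map is still essentially
  surjective, lifts to a surjection `Φq : k[X, Y]_𝔮 ↠ R` with `Φq(Y_j) = u_j`, and the classes
  of the `u_j` form a basis of `𝔪/𝔪²` (`d` spanning vectors in a `d`-dimensional space), so
  `exists_dual_derivations` (`…PthPowerModMonomialPresentation.lean`) applies to `F_j = Y_j`.
-/

set_option linter.dupNamespace false

namespace Summit.ResolutionOfSingularities.ResolutionOfSingularities.Theorems.PfaffLine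

open IsLocalRing MvPolynomial

/-! ## Dual derivations for an arbitrary regular system of parameters -/

/-- **Dual derivations of a regular system of parameters, abstract form.** Let `R` be a regular
local ring which is essentially a quotient of `k[X_1, …, X_n]` (every element is a fraction
`Φ F / Φ G` with `Φ G` a unit) and `u_1, …, u_d` generators of `𝔪_R` with `d = dim R`. Then there
are `ℤ`-derivations `D_1, …, D_d` of `R` with `D_i u_j = δ_ij`. (Matsumura, *Commutative Ring
Theory*, proof of Thm. 30.5, through the enlarged presentation `k[X, Y] → R`, `Y_j ↦ u_j`.)
[folklore] -/
theorem exists_dual_derivations_of_presentation {k : Type} [Field k] {n : ℕ} {R : Type}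
    [CommRing R] [Algebra ℤ R] (hreg : IsRegularLocalRing R)
    (Φ : MvPolynomial (Fin n) k →+* R) (hΦ : ∀ r, ∃ F G, IsUnit (Φ G) ∧ r * Φ G = Φ F)
    {d : ℕ} (u : Fin d → R) (hspan : Ideal.span (Set.range u) = maximalIdeal R)
    (hdim : ringKrullDim R = (d : WithBot ℕ∞)) :
    ∃ D : Fin d → Derivation ℤ R R, ∀ i j, D i (u j) = if i = j then 1 else 0 := by
  classical
  haveI := hreg
  -- enlarge the presentation by new variables `Y_j ↦ u_j`
  obtain ⟨Φ', hΦ'X, hΦ'ren⟩ : ∃ Φ' : MvPolynomial (Fin (n + d)) k →+* R,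
      (∀ j, Φ' (X (Fin.natAdd n j)) = u j) ∧
        ∀ F : MvPolynomial (Fin n) k, Φ' (rename (Fin.castAdd d) F) = Φ F := by
    refine ⟨eval₂Hom (Φ.comp C) (Fin.append (fun i => Φ (X i)) u), fun j => ?_, fun F => ?_⟩
    · rw [eval₂Hom_X', Fin.append_right]
    · have hcomp : (eval₂Hom (Φ.comp C) (Fin.append (fun i => Φ (X i)) u)).comp
          (rename (Fin.castAdd d) : MvPolynomial (Fin n) k →ₐ[k] _).toRingHom = Φ := by
        refine ringHom_ext (fun a => ?_) (fun i => ?_)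
        · simp
        · simp [Fin.append_left]
      exact DFunLike.congr_fun hcomp F
  have hΦ'ess : ∀ r, ∃ F G, IsUnit (Φ' G) ∧ r * Φ' G = Φ' F := fun r => by
    obtain ⟨F, G, hG, hr⟩ := hΦ r
    exact ⟨rename (Fin.castAdd d) F, rename (Fin.castAdd d) G, by rwa [hΦ'ren],
      by rwa [hΦ'ren, hΦ'ren]⟩
  -- lift to a surjection `Φq : k[X, Y]_𝔮 ↠ R`
  obtain ⟨Φq, hsurj, hΦq⟩ := exists_surjective_lift Φ' hΦ'ess
  have hum : ∀ j, u j ∈ maximalIdeal R := fun j => hspan ▸ Ideal.subset_span ⟨j, rfl⟩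
  have hFu : ∀ j, Φq (algebraMap _ _ (X (Fin.natAdd n j) : MvPolynomial (Fin (n + d)) k)) = u j :=
    fun j => by rw [hΦq, hΦ'X]
  have hFm : ∀ j, Φq (algebraMap _ _ (X (Fin.natAdd n j) : MvPolynomial (Fin (n + d)) k)) ∈
      maximalIdeal R := fun j => by
    rw [hFu]
    exact hum j
  -- the classes of the `u_j` form a basis of `𝔪/𝔪²`
  have hliF : LinearIndependent (ResidueField R) fun j =>
      (maximalIdeal R).toCotangent ⟨_, hFm j⟩ := by
    have hfin : Module.finrank (ResidueField R) (CotangentSpace R) = d := by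
      have h1 := (IsRegularLocalRing.iff_finrank_cotangentSpace R).mp hreg
      rw [hdim] at h1
      exact_mod_cast h1
    refine linearIndependent_of_top_le_span_of_card_eq_finrank ?_
      (by rw [Fintype.card_fin, hfin])
    have heq : (fun j => (maximalIdeal R).toCotangent ⟨_, hFm j⟩) =
        fun j => (maximalIdeal R).toCotangent ⟨u j, hum j⟩ :=
      funext fun j => congrArg _ (Subtype.ext (hFu j))
    rw [heq]
    have hs : Set.range (fun j => (maximalIdeal R).toCotangent ⟨u j, hum j⟩) =
        (maximalIdeal R).toCotangent '' Set.range (fun j => (⟨u j, hum j⟩ : maximalIdeal R)) := by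
      rw [← Set.range_comp]
      rfl
    rw [hs, top_le_iff, CotangentSpace.span_image_eq_top_iff]
    apply Submodule.map_injective_of_injective (maximalIdeal R).injective_subtype
    rw [Submodule.map_span, Submodule.map_top, Submodule.range_subtype, ← Set.range_comp]
    exact hspan
  -- dual derivations to `F_j = Y_j`
  obtain ⟨D, hD⟩ := exists_dual_derivations k (n + d) _ Φq hsurj
    (fun j => (X (Fin.natAdd n j) : MvPolynomial (Fin (n + d)) k)) hFm hliF
  exact ⟨D, fun i j => by rw [← hFu]; exact hD i j⟩

/-! ## The registered sub-goals -/

/-- **H7a, richness of `Der_ℤ` of the local ring of a finitely generated model at the centre.**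
For `A ⊆ O` a finitely generated `k`-subalgebra (`char k = p`) with `R = A_𝔭` regular at the
centre `𝔭 = 𝔪_O ∩ A`: every `ψ`-derivation `δ₀ : R → N` is, on a finite set `Y`, a finite
combination `δ₀ y = ∑_j ψ(Δ_j y) n_j` of `ℤ`-derivations `Δ_j` of `R`. Instance of
`exists_derivations_sum_eq` through the presentation `k[X]_𝔮 ↠ R` (`exists_presentation`,
`exists_surjective_lift`). [folklore] -/
theorem rich_localization_centre : ∀ (p : ℕ) [Fact p.Prime] (k K : Type) [Field k] [CharP k p] [Field K] [Algebra k K] (O : ValuationSubring K) (A : Subalgebra k K) (h : A.toSubring ≤ O.toSubring), A.FG → IsRegularLocalRing (Localization.AtPrime (Ideal.comap (Subring.inclusion h) (IsLocalRing.maximalIdeal O))) → ∀ (N : Type) [CommRing N] (ψ : Localization.AtPrime (Ideal.comap (Subring.inclusion h) (IsLocalRing.maximalIdeal O)) →+* N) (δ₀ : Localization.AtPrime (Ideal.comap (Subring.inclusion h) (IsLocalRing.maximalIdeal O)) →+ N), (∀ a b, δ₀ (a * b) = ψ a * δ₀ b + ψ b * δ₀ a) → ∀ Y : Finset (Localization.AtPrime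 (Ideal.comap (Subring.inclusion h) (IsLocalRing.maximalIdeal O))), ∃ (m : ℕ) (Δ : Fin m → Derivation ℤ (Localization.AtPrime (Ideal.comap (Subring.inclusion h) (IsLocalRing.maximalIdeal O))) (Localization.AtPrime (Ideal.comap (Subring.inclusion h) (IsLocalRing.maximalIdeal O)))) (nn : Fin m → N), ∀ y ∈ Y, δ₀ y = Finset.univ.sum fun j => ψ (Δ j y) * nn j := by
  intro p _ k K _ _ _ _ O A h hfg hreg N _ ψ δ₀ hleib Y
  -- presentation `k[X]_𝔮 ↠ A_𝔭`
  obtain ⟨n, Φ, hΦ⟩ := exists_presentation O A h hfg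
  obtain ⟨Φq, hsurj, -⟩ := exists_surjective_lift Φ hΦ
  haveI := hreg
  exact exists_derivations_sum_eq k n _ Φq hsurj p N ψ δ₀ hleib Y

/-- **H7b, dual derivations for a regular system of parameters of the local ring of a finitely
generated model at the centre.** For `A ⊆ O` a finitely generated `k`-subalgebra with `R = A_𝔭`
regular at the centre and `u_1, …, u_d` generators of `𝔪_R`, `d = dim R`: there are
`ℤ`-derivations `D_1, …, D_d` of `R` with `D_i u_j = δ_ij`. Instance of
`exists_dual_derivations_of_presentation` (`exists_presentation`). The characteristic
hypotheses are not needed here. [folklore] -/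
theorem exists_dual_derivations_centre : ∀ (p : ℕ) [Fact p.Prime] (k K : Type) [Field k] [CharP k p] [Field K] [Algebra k K] (O : ValuationSubring K) (A : Subalgebra k K) (h : A.toSubring ≤ O.toSubring), A.FG → IsRegularLocalRing (Localization.AtPrime (Ideal.comap (Subring.inclusion h) (IsLocalRing.maximalIdeal O))) → ∀ {d : ℕ} (u : Fin d → Localization.AtPrime (Ideal.comap (Subring.inclusion h) (IsLocalRing.maximalIdeal O))), Ideal.span (Set.range u) = IsLocalRing.maximalIdeal (Localization.AtPrime (Ideal.comap (Subring.inclusion h) (IsLocalRing.maximalIdeal O))) → ringKrullDim (Localization.AtPrime (Ideal.comap (Subring.inclusion h) (IsLocalRing.maximalIdeal O))) = (d : WithBot ℕ∞) → ∃ D : Fin d → Derivation ℤ (Localization.AtPrime (Ideal.comap (Subring.inclusion h) (IsLocalRing.maximalIdeal O))) (Localization.AtPrime (Ideal.comap (Subring.inclusion h) (IsLocalRing.maximalIdeal O))), ∀ i j, D i (u j) = if i = j then 1 else 0 := by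
  intro _ _ k K _ _ _ _ O A h hfg hreg d u hspan hdim
  -- presentation `k[X] → A_𝔭`
  obtain ⟨n, Φ, hΦ⟩ := exists_presentation O A h hfg
  exact exists_dual_derivations_of_presentation hreg Φ hΦ u hspan hdim

end Summit.ResolutionOfSingularities.ResolutionOfSingularities.Theorems.PfaffLine
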